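import Mathlib
import HarnessLib
import Summits.HubbardSuperconductivity.HubbardSuperconductivity.Theorems.KLProgrammeKLRegimeVolumeLimitLastScalePlainRowsDoor

/-!
# Route `KLProgramme` — crux K3, VL child (stmt-HubbardSuperconductivity-20440), keying «(VL)-SRC-WINDOW» (R227) (β): THE BOTTOM FOURIER STEP FOR
# MULTIPLIER-DRESSED SOURCE LEGS — the END read-out is untouched by a one-sector multiplier that equals `1` at the read label
# (cell gate-hubbard-kl, seat p1 g22, item (β) assigned by the pen 16:52Z; spec hubbard-kl-k3c4-p1 g16 STATUS 16:33Z)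

Under the window key the two-volume chain's last object is the SOURCE-SMOOTHED action `srcSmooth V M n⋆ (klSrcAction …)`, whose two-source-leg kernels are the
two-leg kernels of `𝒱⁽ⁿ⋆⁾[K_V]` read through `E(F_χ)` instead of `E_plain` — i.e. `sectorisedKernel V M β F (klEffectiveAction …) 2` with a ONE-SECTOR multiplier
family `F` (k3c4's `srcWindowFamily V M : Fin 1 → FreqMomentum V M → ℂ`, `F 0 (j,k⃗) = w_j = χ((2n_j+1)/M)`) in place of `trivialMultiplier`.  This file is the
bottom step of `…LastScalePlainRowsDoor` §1 for such rows, generic in `F`: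
* §1 `dualKernel_two_family_eq_of_diagonal` — for an element with diagonal `(+,−)` two-leg momentum kernel,
  `W^F_σ(G)(x₀,x₁) = Σ_k F₀(k)·F₀(k)·kernel G 2 ((k,σ,+),(k,σ,−))·e^{iω_k(t₁−t₀)}χ_{k⃗}(x⃗₁−x⃗₀)`;
  `row_family_eq_of_diagonal` — the phase-weighted row at label `ω_m` is `2M·Σ_{k⃗} F₀(m,k⃗)²·kernel·χ_{k⃗}(z)` (base-point free);
  **`row_family_eq_row_of_eq_one`** — if `F₀(m,k⃗) = 1` for all `k⃗` (the window at a kept label: k3c4's `srcWindowWt_eq_one`, `|2n_m+1| ≤ M/2`), the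
  `F`-row at label `m` IS the plain row (`row_eq_of_diagonal`);
* §2 **`norm_klSelfEnergy_sub_le_familyDualDefect`** — `…PlainRowsDoor.norm_klSelfEnergy_sub_le_plainDualDefect` VERBATIM with the three
  `trivialMultiplier` rows replaced by `F_c`- and `F_f`-rows, under `hFc : ∀ k⃗, F_c 0 (ω,k⃗) = 1`, `hFf : ∀ k⃗, F_f 0 (ω,k⃗) = 1`:
  `‖Σ^{K_c}_{L_c}(ω,k) − Σ^{K_f}_{L_f}(ω,k″)‖ ≤ 2ε·(Ddef₊^F + Dfar₊^F)`; `norm_klSelfEnergy_le_familyDualRows` — the one-volume size.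
The instance `F = srcWindowFamily` with `hM : 4|n|+2 ≤ M` (`norm_klSelfEnergy_sub_le_windowedDualDefect`) is one line once k3c4's
`…TwoVolumeSourceSmoothDefs` is in the tree; the door twins above it are token work over this file.

Proofs only; no definition; nothing asserts HB1, any VL stub, K3 or superconductivity.
References: BGM 2006 §2.1 (2.4)–(2.5), §2.4 (2.38), §2.9 (4.6) [cite: BenfattoGiulianiMastropietro2006]; Salmhofer 1999 App. B.5.5 [cite: Salmhofer1999].
-/

noncomputable section

namespace Summit.HubbardSuperconductivity.HubbardSuperconductivity.Theorems.TwoVolumeDefect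

set_option linter.dupNamespace false -- summit = problem name (single-conjunct summit), D-0017

open Finset Complex Literature.MathematicalPhysics.QuantumLattice Literature.Probability.LatticeModels GrassmannAlgebra
open Summit.HubbardSuperconductivity.HubbardSuperconductivity.Theorems.KLRegimeSplit
open Summit.HubbardSuperconductivity.HubbardSuperconductivity.Theorems.KLProgrammeLegKernels
open Summit.HubbardSuperconductivity.HubbardSuperconductivity.Theorems.TwoLegFourier
open Summit.HubbardSuperconductivity.HubbardSuperconductivity.Theorems.KLRegimeWick
open scoped ComplexConjugate

/-! ## §1 Rows of a one-sector multiplier family on a diagonal element -/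

section Rows

variable {L M : ℕ} [NeZero L] [NeZero M]

omit [NeZero M] in
/-- **The `F`-dressed dual-lattice two-leg kernel of an element with DIAGONAL `(+,−)` momentum kernel** (one-sector family `F`):
`W^F_σ(G)(x₀, x₁) = Σ_k F₀(k)·F₀(k)·kernel G 2 ((k,σ,+),(k,σ,−))·e^{iω_k(t₁ − t₀)}·χ_{k⃗}(x⃗₁ − x⃗₀)`. -/
theorem dualKernel_two_family_eq_of_diagonal (β : ℝ) (F : Fin 1 → FreqMomentum L M → ℂ) (G : HubbardGrassmann L M) (σ : Fin 2)
    (hdiag : ∀ k k' : FreqMomentum L M, k' ≠ k → kernel ℂ G 2 ![((k, σ), 0), ((k', σ), 1)] = 0) (x₀ x₁ : SpaceTimeIdx L M) :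
    sectorisedKernel L M β F G 2 (![((0, σ), 0), ((0, σ), 1)] : Fin 2 → SectorLeg 1) ![x₀, x₁] =
      ∑ k : FreqMomentum L M, (F 0 k * F 0 k) * (kernel ℂ G 2 ![((k, σ), 0), ((k, σ), 1)] *
        (Complex.exp (((matsubaraFreq β M k.1 * (imagTime β M x₁.1 - imagTime β M x₀.1) : ℝ) : ℂ) * I) * torusChar k.2 (x₁.2 - x₀.2))) := by
  rw [sectorisedKernel_def]
  -- reindex the pair of momenta
  rw [← Fintype.sum_equiv (finTwoArrowEquiv (FreqMomentum L M)).symm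
    (fun p : FreqMomentum L M × FreqMomentum L M => (∏ i : Fin 2, F ((![((0, σ), 0), ((0, σ), 1)] : Fin 2 → SectorLeg 1) i).1.1
        ((![p.1, p.2] : Fin 2 → FreqMomentum L M) i) * hubbardPlaneWave L M β
      ((![((0, σ), 0), ((0, σ), 1)] : Fin 2 → SectorLeg 1) i).2 ((![p.1, p.2] : Fin 2 → FreqMomentum L M) i)
        ((![x₀, x₁] : Fin 2 → SpaceTimeIdx L M) i)) *
      kernel ℂ G 2 (fun i => ((((![p.1, p.2] : Fin 2 → FreqMomentum L M) i),
        ((![((0, σ), 0), ((0, σ), 1)] : Fin 2 → SectorLeg 1) i).1.2), ((![((0, σ), 0), ((0, σ), 1)] : Fin 2 → SectorLeg 1) i).2)))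
    _ (fun p => by simp only [finTwoArrowEquiv_symm_apply])]
  rw [Fintype.sum_prod_type]
  refine sum_congr rfl fun k _ => ?_
  -- the labels of the string at the pair `(k, k')`
  have hX : ∀ k' : FreqMomentum L M, (fun i : Fin 2 => ((((![k, k'] : Fin 2 → FreqMomentum L M) i),
      ((![((0, σ), 0), ((0, σ), 1)] : Fin 2 → SectorLeg 1) i).1.2), ((![((0, σ), 0), ((0, σ), 1)] : Fin 2 → SectorLeg 1) i).2)) =
      ![((k, σ), 0), ((k', σ), 1)] := fun k' => by funext i; fin_cases i <;> rfl
  simp_rw [hX]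
  rw [Finset.sum_eq_single k (fun k' _ hk' => by rw [hdiag k k' hk', mul_zero]) (fun h => absurd (mem_univ k) h)]
  simp only [Fin.prod_univ_two, Matrix.cons_val_zero, Matrix.cons_val_one]
  have hpw : hubbardPlaneWave L M β 0 k x₀ * hubbardPlaneWave L M β 1 k x₁ =
      Complex.exp (((matsubaraFreq β M k.1 * (imagTime β M x₁.1 - imagTime β M x₀.1) : ℝ) : ℂ) * I) * torusChar k.2 (x₁.2 - x₀.2) := by
    rw [hubbardPlaneWave_zero_mul_one, ← conj_hubbardPlaneWave_zero_mul_one, conj_phase_eq_cexp_mul_torusChar]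
  calc F 0 k * hubbardPlaneWave L M β 0 k x₀ * (F 0 k * hubbardPlaneWave L M β 1 k x₁) * kernel ℂ G 2 ![((k, σ), 0), ((k, σ), 1)]
      = (F 0 k * F 0 k) * (kernel ℂ G 2 ![((k, σ), 0), ((k, σ), 1)] * (hubbardPlaneWave L M β 0 k x₀ * hubbardPlaneWave L M β 1 k x₁)) := by ring
    _ = _ := by rw [hpw]

omit [NeZero M] in
/-- **THE `F`-ROW FORMULA**: for an element with diagonal `(+,−)` two-leg momentum kernel at spin `σ` (`β ≠ 0`) and a one-sector family `F`, the phase-weighted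
`F`-row at ANY base point `x₀` is `R^F(x₀; z) = 2M · Σ_{k⃗} F₀(ω,k⃗)²·kernel G 2 (((ω,k⃗),σ,+),((ω,k⃗),σ,−))·χ_{k⃗}(z)`. -/
theorem row_family_eq_of_diagonal {β : ℝ} (hβ : β ≠ 0) (F : Fin 1 → FreqMomentum L M → ℂ) (G : HubbardGrassmann L M) (m : MatsubaraIdx M) (σ : Fin 2)
    (hdiag : ∀ k k' : FreqMomentum L M, k' ≠ k → kernel ℂ G 2 ![((k, σ), 0), ((k', σ), 1)] = 0) (x₀ : SpaceTimeIdx L M)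
    (z : TorusSite 2 L) :
    (∑ t₁ : ImagTimeIdx M,
        sectorisedKernel L M β F G 2 (![((0, σ), 0), ((0, σ), 1)] : Fin 2 → SectorLeg 1) ![x₀, (t₁, x₀.2 + z)] *
          Complex.exp (((matsubaraFreq β M m * (imagTime β M x₀.1 - imagTime β M t₁) : ℝ) : ℂ) * I)) =
      ((2 * M : ℕ) : ℂ) * ∑ kv : TorusSite 2 L, (F 0 (m, kv) * F 0 (m, kv)) * (kernel ℂ G 2 ![(((m, kv), σ), 0), (((m, kv), σ), 1)] * torusChar kv z) := by
  simp_rw [dualKernel_two_family_eq_of_diagonal β F G σ hdiag, add_sub_cancel_left, sum_mul]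
  rw [sum_comm]
  -- each momentum term: the time sum is Salmhofer's orthogonality
  have hterm : ∀ k : FreqMomentum L M, ∑ t₁ : ImagTimeIdx M, (F 0 k * F 0 k) * (kernel ℂ G 2 ![((k, σ), 0), ((k, σ), 1)] *
      (Complex.exp (((matsubaraFreq β M k.1 * (imagTime β M t₁ - imagTime β M x₀.1) : ℝ) : ℂ) * I) * torusChar k.2 z)) *
        Complex.exp (((matsubaraFreq β M m * (imagTime β M x₀.1 - imagTime β M t₁) : ℝ) : ℂ) * I) =
      (F 0 k * F 0 k) * (kernel ℂ G 2 ![((k, σ), 0), ((k, σ), 1)] * torusChar k.2 z) *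
        Complex.exp (-(((matsubaraFreq β M k.1 - matsubaraFreq β M m) * imagTime β M x₀.1 : ℝ) : ℂ) * I) *
        ∑ t₁ : ImagTimeIdx M, Complex.exp (-((chargeSign 1 * ((matsubaraFreq β M k.1 - matsubaraFreq β M m) *
          imagTime β M t₁) : ℝ) : ℂ) * I) := by
    intro k
    rw [mul_sum]
    refine sum_congr rfl fun t₁ _ => ?_
    have hcs : chargeSign 1 = -1 := by unfold chargeSign; simp
    rw [hcs]
    have hexp : Complex.exp (((matsubaraFreq β M k.1 * (imagTime β M t₁ - imagTime β M x₀.1) : ℝ) : ℂ) * I) *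
        Complex.exp (((matsubaraFreq β M m * (imagTime β M x₀.1 - imagTime β M t₁) : ℝ) : ℂ) * I) =
        Complex.exp (-(((matsubaraFreq β M k.1 - matsubaraFreq β M m) * imagTime β M x₀.1 : ℝ) : ℂ) * I) *
          Complex.exp (-((-1 * ((matsubaraFreq β M k.1 - matsubaraFreq β M m) * imagTime β M t₁) : ℝ) : ℂ) * I) := by
      rw [← Complex.exp_add, ← Complex.exp_add]
      congr 1
      push_cast
      ring
    calc (F 0 k * F 0 k) * (kernel ℂ G 2 ![((k, σ), 0), ((k, σ), 1)] *
          (Complex.exp (((matsubaraFreq β M k.1 * (imagTime β M t₁ - imagTime β M x₀.1) : ℝ) : ℂ) * I) * torusChar k.2 z)) *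
          Complex.exp (((matsubaraFreq β M m * (imagTime β M x₀.1 - imagTime β M t₁) : ℝ) : ℂ) * I)
        = (F 0 k * F 0 k) * (kernel ℂ G 2 ![((k, σ), 0), ((k, σ), 1)] * torusChar k.2 z) *
          (Complex.exp (((matsubaraFreq β M k.1 * (imagTime β M t₁ - imagTime β M x₀.1) : ℝ) : ℂ) * I) *
            Complex.exp (((matsubaraFreq β M m * (imagTime β M x₀.1 - imagTime β M t₁) : ℝ) : ℂ) * I)) := by ring
      _ = _ := by rw [hexp]; ring
  simp_rw [hterm, sum_imagTime_cexp hβ 1 m]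
  -- only the kept frequency `m` survives
  rw [Fintype.sum_prod_type, mul_sum]
  rw [Finset.sum_eq_single m (fun m' _ hm' => by simp [hm']) (fun h => absurd (mem_univ m) h)]
  refine sum_congr rfl fun kv _ => ?_
  simp only [if_true, sub_self, zero_mul, Complex.ofReal_zero, neg_zero, Complex.exp_zero, mul_one]
  ring

omit [NeZero M] in
/-- **AT A KEPT LABEL THE `F`-ROW IS THE PLAIN ROW**: if `F₀(m, k⃗) = 1` for every `k⃗` (the window at a label with `|2n_m+1| ≤ M/2`), then for an element with
diagonal `(+,−)` two-leg momentum kernel the phase-weighted `F`-row at label `m` equals the `trivialMultiplier` row (`row_eq_of_diagonal`). -/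
theorem row_family_eq_row_of_eq_one {β : ℝ} (hβ : β ≠ 0) (F : Fin 1 → FreqMomentum L M → ℂ) (G : HubbardGrassmann L M) (m : MatsubaraIdx M) (σ : Fin 2)
    (hdiag : ∀ k k' : FreqMomentum L M, k' ≠ k → kernel ℂ G 2 ![((k, σ), 0), ((k', σ), 1)] = 0) (hF : ∀ kv : TorusSite 2 L, F 0 (m, kv) = 1)
    (x₀ : SpaceTimeIdx L M) (z : TorusSite 2 L) :
    (∑ t₁ : ImagTimeIdx M,
        sectorisedKernel L M β F G 2 (![((0, σ), 0), ((0, σ), 1)] : Fin 2 → SectorLeg 1) ![x₀, (t₁, x₀.2 + z)] *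
          Complex.exp (((matsubaraFreq β M m * (imagTime β M x₀.1 - imagTime β M t₁) : ℝ) : ℂ) * I)) =
      ∑ t₁ : ImagTimeIdx M,
        sectorisedKernel L M β (trivialMultiplier L M) G 2 (![((0, σ), 0), ((0, σ), 1)] : Fin 2 → SectorLeg 1) ![x₀, (t₁, x₀.2 + z)] *
          Complex.exp (((matsubaraFreq β M m * (imagTime β M x₀.1 - imagTime β M t₁) : ℝ) : ℂ) * I) := by
  rw [row_family_eq_of_diagonal hβ F G m σ hdiag x₀ z, row_eq_of_diagonal hβ G m σ hdiag x₀ z]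
  congr 1
  refine sum_congr rfl fun kv _ => ?_
  rw [hF kv, one_mul, one_mul]

end Rows

/-! ## §2 The VL read-out for the action itself with multiplier-dressed rows -/

section FamilyModel

variable {Lc Lf b M : ℕ} [NeZero Lc] [NeZero Lf] [NeZero M]

/-- The action has a diagonal `(+,−)` two-leg momentum kernel (private twin of `…LastScaleDressedRows.kernel_two_offDiag_klEffectiveAction`, not imported
to stay out of the route cone). -/
private theorem kernel_two_offDiag_klEffectiveAction' (β U μ : ℝ) (K : TrigPolyC4v) (n : ℕ) (σ : Fin 2) (k k' : FreqMomentum Lc M) (hk : k' ≠ k) :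
    kernel ℂ (klEffectiveAction Lc M β U μ K klE0 n) 2 ![((k, σ), 0), ((k', σ), 1)] = 0 := by
  have h := kernel_two_offDiag_klEffectiveAction_sub_counter (L := Lc) (M := M) β U μ K n σ k k' hk
  rwa [TwoLegFourier.kernel_sub', kernel_counterQuadratic_two_offDiag β K σ hk, sub_zero] at h

/-- **THE VL READ-OUT FOR THE ACTION ITSELF WITH MULTIPLIER-DRESSED ROWS, TWO VOLUMES, ANY TWO FRAMES** (`0 < β`, `L_f = b·L_c`, common `M`, scale `n`,
label `ω`, spin `σ`, ANY pins, `p_{k″} = p_k`; one-sector families `F_c`, `F_f` with `F_c 0 (ω,k⃗) = 1`, `F_f 0 (ω,k⃗) = 1` — the window at a kept label):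
`‖Σ^{K_c}_{L_c}(ω,k) − Σ^{K_f}_{L_f}(ω,k″)‖ ≤ 2ε·(Ddef₊^F + Dfar₊^F)` for the `F`-rows of `𝒱_c[K_c]`, `𝒱_f[K_f]` — `norm_klSelfEnergy_sub_le_plainDualDefect` after
`row_family_eq_row_of_eq_one`. [cite: BenfattoGiulianiMastropietro2006, §2.4 (2.38)] -/
theorem norm_klSelfEnergy_sub_le_familyDualDefect (hL : Lf = b * Lc) {β : ℝ} (hβ : 0 < β) (U μ : ℝ) (Kc Kf : TrigPolyC4v) (n : ℕ)
    (ω : MatsubaraIdx M) (σ : Fin 2) (Fc : Fin 1 → FreqMomentum Lc M → ℂ) (Ff : Fin 1 → FreqMomentum Lf M → ℂ)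
    (hFc : ∀ kv : TorusSite 2 Lc, Fc 0 (ω, kv) = 1) (hFf : ∀ kv : TorusSite 2 Lf, Ff 0 (ω, kv) = 1)
    (oc : SpaceTimeIdx Lc M) (of : SpaceTimeIdx Lf M)
    {k : TorusSite 2 Lc} {k'' : TorusSite 2 Lf} (hk : latticeMomentum Lf k'' = latticeMomentum Lc k) :
    ‖klSelfEnergy Lc M β U μ Kc klE0 n (ω, k) σ - klSelfEnergy Lf M β U μ Kf klE0 n (ω, k'') σ‖ ≤
      2 * imagTimeWeight β M *
        ((∑ ybar : TorusSite 2 Lc,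
            ‖(∑ t₁ : ImagTimeIdx M,
                sectorisedKernel Lc M β Fc (klEffectiveAction Lc M β U μ Kc klE0 n) 2
                    (![((0, σ), 0), ((0, σ), 1)] : Fin 2 → SectorLeg 1) ![oc, (t₁, oc.2 + ybar)] *
                  Complex.exp (((matsubaraFreq β M ω * (imagTime β M oc.1 - imagTime β M t₁) : ℝ) : ℂ) * I)) -
              (∑ t₁ : ImagTimeIdx M,
                sectorisedKernel Lf M β Ff (klEffectiveAction Lf M β U μ Kf klE0 n) 2
                    (![((0, σ), 0), ((0, σ), 1)] : Fin 2 → SectorLeg 1) ![of, (t₁, of.2 + Torus.proj Lf (Torus.cRep ybar))] *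
                  Complex.exp (((matsubaraFreq β M ω * (imagTime β M of.1 - imagTime β M t₁) : ℝ) : ℂ) * I))‖) +
          ∑ y ∈ univ.filter (fun y : TorusSite 2 Lf => Torus.proj Lf (Torus.cRep (fun i => (((y i).val : ℕ) : ZMod Lc))) ≠ y),
            ‖∑ t₁ : ImagTimeIdx M,
                sectorisedKernel Lf M β Ff (klEffectiveAction Lf M β U μ Kf klE0 n) 2
                    (![((0, σ), 0), ((0, σ), 1)] : Fin 2 → SectorLeg 1) ![of, (t₁, of.2 + y)] *
                  Complex.exp (((matsubaraFreq β M ω * (imagTime β M of.1 - imagTime β M t₁) : ℝ) : ℂ) * I)‖) := by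
  have hdc := kernel_two_offDiag_klEffectiveAction' (Lc := Lc) (M := M) β U μ Kc n σ
  have hdf := kernel_two_offDiag_klEffectiveAction' (Lc := Lf) (M := M) β U μ Kf n σ
  simp_rw [row_family_eq_row_of_eq_one hβ.ne' Fc _ ω σ hdc hFc, row_family_eq_row_of_eq_one hβ.ne' Ff _ ω σ hdf hFf]
  exact norm_klSelfEnergy_sub_le_plainDualDefect hL hβ U μ Kc Kf n ω σ oc of hk

omit [NeZero Lf] in
/-- **One-volume size with multiplier-dressed rows**: `‖Σ^K_L(ω,k)‖ ≤ 2ε·Σ_y ‖R^F(o;y)‖` at a kept label (`F 0 (ω,k⃗) = 1`). [cite: BenfattoGiulianiMastropietro2006, §2.1 (2.5)] -/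
theorem norm_klSelfEnergy_le_familyDualRows {β : ℝ} (hβ : 0 < β) (U μ : ℝ) (K : TrigPolyC4v) (n : ℕ) (ω : MatsubaraIdx M) (σ : Fin 2)
    (F : Fin 1 → FreqMomentum Lc M → ℂ) (hF : ∀ kv : TorusSite 2 Lc, F 0 (ω, kv) = 1) (o : SpaceTimeIdx Lc M) (k : TorusSite 2 Lc) :
    ‖klSelfEnergy Lc M β U μ K klE0 n (ω, k) σ‖ ≤ 2 * imagTimeWeight β M * ∑ y : TorusSite 2 Lc,
      ‖∑ t₁ : ImagTimeIdx M,
          sectorisedKernel Lc M β F (klEffectiveAction Lc M β U μ K klE0 n) 2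
              (![((0, σ), 0), ((0, σ), 1)] : Fin 2 → SectorLeg 1) ![o, (t₁, o.2 + y)] *
            Complex.exp (((matsubaraFreq β M ω * (imagTime β M o.1 - imagTime β M t₁) : ℝ) : ℂ) * I)‖ := by
  have hd := kernel_two_offDiag_klEffectiveAction' (Lc := Lc) (M := M) β U μ K n σ
  simp_rw [row_family_eq_row_of_eq_one hβ.ne' F _ ω σ hd hF]
  exact norm_klSelfEnergy_le_plainDualRows hβ U μ K n ω σ o k

end FamilyModel

end Summit.HubbardSuperconductivity.HubbardSuperconductivity.Theorems.TwoVolumeDefect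

end
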